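import Literature.AlgebraicGeometry.Modules.CechThetaVanishing
import Literature.AlgebraicGeometry.KTheory.PullbackVectorBundle
import Mathlib.AlgebraicGeometry.Morphisms.ClosedImmersion
import HarnessLib

/-!
# Vanishing Čech `Ext`-classes on covers pulled back from affine opens of an ambient scheme

Setting: morphisms of schemes `Y —j→ Z₀ —i→ Z₁` which are closed immersions (so `Y → Z₁` is a
closed embedding), affine opens `U_z ∋ z` of `Z₁` indexed by the points `z ∈ Z₁`, and the induced
cover `𝓤^Y = (j⁻¹i⁻¹U_z)_z` of `Y`; `E` a finite locally free `𝒪_Y`-module and `M` any `𝒪_Y`-module.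
This is the situation of the obstruction cocycle of a framed module across a thickening
(`Deformation/ObstructionCocycle.lean`), read on the base `Y`.

* `Cech.exists_retraction_over_basicOpen` — **the local retraction oracle**: every extension
  `0 → Č⁰(𝓤^Y, M) → X' → E → 0` splits over `j⁻¹i⁻¹D(f)` for some basic open `D(f) ∋ z` of the
  affine `U_z`, for every `z` (split near a point of `Y` over `z` by local freeness of `E`,
  `KTheory.exists_isSplitMono_over_of_shortExact`; transport the neighbourhood to `Z₁` along the
  closed embedding; shrink to a basic open; if no point of `Y` lies over `z`, shrink `U_z` off the
  closed image of `Y`, where the extension is an extension of sheaves with no sections);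
* `Cech.exists_basicOpen_refinement_eq_dFamily` — hence (`Modules/CechThetaVanishing.lean`) **a
  `2`-cocycle `ω` of local homomorphisms `E → M` on `𝓤^Y` with `[ω] = 0 ∈ Ext²(E, M)` becomes a
  coboundary `ω|_𝓥 = dβ` on the refinement `𝓥 = (j⁻¹i⁻¹D(f_z))_z` by basic opens `D(f_z) ∋ z`,
  `f_z ∈ Γ(Z₁, U_z)`** — same index set, all finite intersections of the `D(f_z)` again basic opens of
  the corresponding intersections of the `U_z` (so affine when those are).

Everything is proved; no named facts.

## References

* R. Hartshorne, *Algebraic Geometry*, GTM 52 (1977), III Lemma 4.4, II Ex. 5.7. [Hartshorne1977]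
* The Stacks Project, Tags 01EW, 08L8. [StacksProject]
-/

noncomputable section

universe u

open CategoryTheory CategoryTheory.Abelian AlgebraicGeometry Opposite TopologicalSpace Limits
  Topology

namespace Literature.AlgebraicGeometry.Modules

open Literature.AlgebraicGeometry.Motives Literature.AlgebraicGeometry.KTheory

namespace Cech

variable {Y Z₀ Z₁ : Scheme.{u}} (j : Y ⟶ Z₀) (i : Z₀ ⟶ Z₁)

/-! ### Sheaves have no sections over empty opens -/

/-- Sections of an `𝒪_Y`-module over an empty open are zero. [folklore] -/
lemma sections_eq_zero_of_eq_bot (M : Y.Modules) {W : Y.Opens} (hW : W = ⊥) (s : Γ(M, W)) : s = 0 :=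
  haveI : Subsingleton Γ(M, W) := AddCommGrpCat.subsingleton_of_isZero
    ((TopCat.Sheaf.isTerminalOfEqEmpty (⟨M.presheaf, Scheme.Modules.isSheaf M⟩ : TopCat.Sheaf Ab Y) hW).isZero)
  Subsingleton.elim _ _

/-- Over an empty open every morphism of restricted modules is a retraction of every other:
`φ ≫ 0 = 𝟙`. [folklore] -/
lemma comp_zero_eq_id_of_eq_bot {A B : Y.Modules} {W : Y.Opens} (hW : (W : Set Y) = ∅)
    (φ : A.over W ⟶ B.over W) : φ ≫ (0 : B.over W ⟶ A.over W) = 𝟙 _ := by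
  rw [comp_zero]
  refine hom_ext_of_appLE fun W' k s => ?_
  have hW' : W' = ⊥ := by
    apply le_bot_iff.mp
    intro y hy
    have : y ∈ (W : Set Y) := k.le hy
    rw [hW] at this
    exact this.elim
  rw [sections_eq_zero_of_eq_bot A hW' s, appLE_zero_right, appLE_zero_right]

/-! ### Opens of `Y` come from `Z₁` -/

section Embedding

variable [IsClosedImmersion j] [IsClosedImmersion i]

/-- `Y → Z₁` is a closed embedding. [folklore] -/
lemma isClosedEmbedding_comp : IsClosedEmbedding (fun y : Y => i (j y)) :=
  i.isClosedEmbedding.comp j.isClosedEmbedding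

/-- Every open of `Y` is the preimage of an open of `Z₁`. [folklore] -/
lemma exists_preimage_eq (W : Y.Opens) : ∃ O : Z₁.Opens, j ⁻¹ᵁ i ⁻¹ᵁ O = W := by
  obtain ⟨t, ht, hW⟩ := (isClosedEmbedding_comp j i).isInducing.isOpen_iff.mp W.isOpen
  exact ⟨⟨t, ht⟩, Opens.ext hW⟩

/-- The complement of the image of `Y` is open in `Z₁`. [folklore] -/
def imageCompl : Z₁.Opens :=
  ⟨(Set.range fun y : Y => i (j y))ᶜ, (isClosedEmbedding_comp j i).isClosed_range.isOpen_compl⟩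

/-- Nothing of `Y` lies over the complement of its image. [folklore] -/
lemma preimage_imageCompl : ((j ⁻¹ᵁ i ⁻¹ᵁ imageCompl j i : Y.Opens) : Set Y) = ∅ :=
  Set.eq_empty_iff_forall_notMem.mpr fun y hy => hy ⟨y, rfl⟩

end Embedding

/-! ### The local retraction oracle -/

variable {ι : Type u} (U : ι → Z₁.Opens)

/-- Monotonicity of `W ↦ j⁻¹i⁻¹W`. [folklore] -/
lemma preimage₂_mono {W W' : Z₁.Opens} (h : W ≤ W') : j ⁻¹ᵁ i ⁻¹ᵁ W ≤ j ⁻¹ᵁ i ⁻¹ᵁ W' :=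
  fun _ hy => h hy

/-- A retraction over `W` restricts to a retraction over `V ≤ W`. [folklore] -/
lemma retraction_restrict {A B : Y.Modules} (f : A ⟶ B) {W V : Y.Opens} (h : V ≤ W)
    (r : B.over W ⟶ A.over W) (hr : (Scheme.Modules.overFunctor W).map f ≫ r = 𝟙 _) :
    (Scheme.Modules.overFunctor V).map f ≫ restrictHom (homOfLE h) r = 𝟙 _ := by
  have h' : restrictHom (homOfLE h) ((SheafOfModules.overFunctor _ W).map f ≫ r) = 𝟙 _ := by
    rw [show (SheafOfModules.overFunctor _ W).map f ≫ r = 𝟙 _ from hr, restrictHom_id]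
  rw [restrictHom_comp, restrictHom_over_map] at h'
  exact h'

variable [IsClosedImmersion j] [IsClosedImmersion i]

/-- **The local retraction oracle.** Let `U_a` be affine opens of `Z₁` with chosen points
`x_a ∈ U_a`, `E` finite locally free on `Y`, and `0 → Č⁰(𝓤^Y, M) —f→ X' → E → 0` exact, where
`𝓤^Y = (j⁻¹i⁻¹U_a)_a`. Then for every `a` there is `g ∈ Γ(Z₁, U_a)` with `x_a ∈ D(g)` such that `f`
has a retraction over `j⁻¹i⁻¹D(g)`. [cite: Hartshorne1977, II Ex. 5.7 and III Lemma 4.4] -/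
theorem exists_retraction_over_basicOpen (hUaff : ∀ a, IsAffineOpen (U a)) (x : ι → Z₁)
    (hx : ∀ a, x a ∈ U a) {E M : Y.Modules} (hE : IsFiniteLocallyFree E) (X' : Y.Modules)
    (f : obj (fun a => j ⁻¹ᵁ i ⁻¹ᵁ U a) 0 M ⟶ X') (g : X' ⟶ E) (w : f ≫ g = 0)
    (hS : (ShortComplex.mk f g w).ShortExact) (a : ι) :
    ∃ φ : Γ(Z₁, U a), x a ∈ Z₁.basicOpen φ ∧
      ∃ r : X'.over (j ⁻¹ᵁ i ⁻¹ᵁ Z₁.basicOpen φ) ⟶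
          (obj (fun a => j ⁻¹ᵁ i ⁻¹ᵁ U a) 0 M).over (j ⁻¹ᵁ i ⁻¹ᵁ Z₁.basicOpen φ),
        (Scheme.Modules.overFunctor (j ⁻¹ᵁ i ⁻¹ᵁ Z₁.basicOpen φ)).map f ≫ r = 𝟙 _ := by
  by_cases hxa : ∃ y : Y, i (j y) = x a
  · -- split near a point `y` over `x_a`, transport the neighbourhood to `Z₁`, shrink to a basic open
    obtain ⟨y, hy⟩ := hxa
    obtain ⟨W, hyW, hW⟩ := exists_isSplitMono_over_of_shortExact hS hE y
    obtain ⟨O, hO⟩ := exists_preimage_eq j i W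
    have hxO : x a ∈ O := by
      have : y ∈ j ⁻¹ᵁ i ⁻¹ᵁ O := by rw [hO]; exact hyW
      rw [← hy]; exact this
    obtain ⟨φ, hφO, hxφ⟩ := (hUaff a).exists_basicOpen_le ⟨x a, show x a ∈ U a ⊓ O from ⟨hx a, hxO⟩⟩ (hx a)
    refine ⟨φ, hxφ, ?_⟩
    have hle : j ⁻¹ᵁ i ⁻¹ᵁ Z₁.basicOpen φ ≤ W := by
      rw [← hO]; exact preimage₂_mono j i (hφO.trans inf_le_right)
    obtain ⟨sm⟩ := hW.exists_splitMono
    exact ⟨restrictHom (homOfLE hle) sm.retraction, retraction_restrict f hle _ sm.id⟩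
  · -- no point of `Y` over `x_a`: shrink `U_a` off the image of `Y`
    push Not at hxa
    have hxO : x a ∈ imageCompl j i := fun ⟨y, hy⟩ => hxa y hy
    obtain ⟨φ, hφO, hxφ⟩ := (hUaff a).exists_basicOpen_le
      ⟨x a, show x a ∈ U a ⊓ imageCompl j i from ⟨hx a, hxO⟩⟩ (hx a)
    refine ⟨φ, hxφ, 0, comp_zero_eq_id_of_eq_bot ?_ _⟩
    apply Set.eq_empty_of_subset_empty
    rw [← preimage_imageCompl j i]
    exact preimage₂_mono j i (hφO.trans inf_le_right)

/-! ### Vanishing classes are coboundaries on a basic-open refinement -/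

variable {U' : Z₁ → Z₁.Opens}

omit [IsClosedImmersion j] [IsClosedImmersion i] in
/-- The opens `j⁻¹i⁻¹U_z` cover `Y` when `z ∈ U_z` for all `z`. [folklore] -/
lemma iSup_preimage₂_eq_top (hU : ∀ z, z ∈ U' z) : iSup (fun z => j ⁻¹ᵁ i ⁻¹ᵁ U' z) = ⊤ :=
  top_unique fun y _ => Opens.mem_iSup.mpr ⟨i (j y), hU _⟩

variable [HasExt.{u + 1} Y.Modules]

/-- **A `2`-cocycle of local homomorphisms `E → M` on `𝓤^Y = (j⁻¹i⁻¹U_z)_z` with vanishing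
`Ext`-class is a coboundary on the refinement by basic opens**: there are `f_z ∈ Γ(Z₁, U_z)` with
`z ∈ D(f_z)` and a `1`-cochain `β` on `𝓥 = (j⁻¹i⁻¹D(f_z))_z` with `ω|_𝓥 = dβ` (for `E` finite locally
free, `U_z` affine, `j`, `i` closed immersions). [cite: Hartshorne1977, III Lemma 4.4] -/
theorem exists_basicOpen_refinement_eq_dFamily (hU : ∀ z, z ∈ U' z) (hUaff : ∀ z, IsAffineOpen (U' z))
    {E M : Y.Modules} (hE : IsFiniteLocallyFree E)
    (ω : LocalFamily (fun z => j ⁻¹ᵁ i ⁻¹ᵁ U' z) 2 E M) (hω : dFamily ω = 0)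
    (h0 : classOf (exactAugmentation (fun z => j ⁻¹ᵁ i ⁻¹ᵁ U' z) M (iSup_preimage₂_eq_top j i hU)) ω hω = 0) :
    ∃ (φ : ∀ z, Γ(Z₁, U' z)) (_ : ∀ z, z ∈ Z₁.basicOpen (φ z))
      (β : LocalFamily (fun z => j ⁻¹ᵁ i ⁻¹ᵁ Z₁.basicOpen (φ z)) 1 E M),
      restrictFamily (fun z => preimage₂_mono j i (Z₁.basicOpen_le (φ z))) ω = dFamily β := by
  obtain ⟨V, ⟨φ, hφ, rfl⟩, hVU, β, hβ⟩ := exists_refinement_eq_dFamily_of_classOf_eq_zero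
    (iSup_preimage₂_eq_top j i hU) ω hω h0
    (fun V => ∃ φ : ∀ z, Γ(Z₁, U' z), (∀ z, z ∈ Z₁.basicOpen (φ z)) ∧
      V = fun z => j ⁻¹ᵁ i ⁻¹ᵁ Z₁.basicOpen (φ z))
    (fun X' f g w hS => by
      choose φ hφ r hr using
        exists_retraction_over_basicOpen j i U' hUaff id hU hE X' f g w hS
      exact ⟨fun z => j ⁻¹ᵁ i ⁻¹ᵁ Z₁.basicOpen (φ z), ⟨φ, hφ, rfl⟩,
        top_unique fun y _ => Opens.mem_iSup.mpr ⟨i (j y), hφ _⟩,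
        fun z => preimage₂_mono j i (Z₁.basicOpen_le (φ z)), fun z => ⟨r z, hr z⟩⟩)
  exact ⟨φ, hφ, β, hβ⟩


/-! ### Arbitrary index sets with centres -/

omit [HasExt.{u + 1} Y.Modules] [IsClosedImmersion j] [IsClosedImmersion i] in
/-- The opens `j⁻¹i⁻¹U_a` cover `Y` when the centres `x_a ∈ U_a` hit every point of `Y`. [folklore] -/
lemma iSup_preimage₂_eq_top_of_centres (x : ι → Z₁) (hx : ∀ a, x a ∈ U a)
    (hsurj : ∀ y : Y, ∃ a, x a = i (j y)) : iSup (fun a => j ⁻¹ᵁ i ⁻¹ᵁ U a) = ⊤ :=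
  top_unique fun y _ => Opens.mem_iSup.mpr (by
    obtain ⟨a, ha⟩ := hsurj y
    exact ⟨a, show i (j y) ∈ U a from ha ▸ hx a⟩)

/-- **Centres version, arbitrary index set.** Let `U_a` (`a ∈ ι`) be affine opens of `Z₁` with
centres `x_a ∈ U_a` hitting every point of `Y` (`∀ y, ∃ a, x_a = i(j(y))`; e.g. `ι = Z₁`, `x = id`),
`E` finite locally free on `Y` and `ω` a `2`-cocycle of local homomorphisms `E → M` on
`𝓤^Y = (j⁻¹i⁻¹U_a)_a` with `[ω] = 0 ∈ Ext²(E, M)`. Then there are `f_a ∈ Γ(Z₁, U_a)` with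
`x_a ∈ D(f_a)` and a `1`-cochain `β` on the refinement `(j⁻¹i⁻¹D(f_a))_a` (SAME index set, again a
cover) with `ω| = dβ`. [cite: Hartshorne1977, III Lemma 4.4] -/
theorem exists_basicOpen_refinement_eq_dFamily_of_centres (hUaff : ∀ a, IsAffineOpen (U a))
    (x : ι → Z₁) (hx : ∀ a, x a ∈ U a) (hsurj : ∀ y : Y, ∃ a, x a = i (j y))
    {E M : Y.Modules} (hE : IsFiniteLocallyFree E)
    (ω : LocalFamily (fun a => j ⁻¹ᵁ i ⁻¹ᵁ U a) 2 E M) (hω : dFamily ω = 0)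
    (hcov : iSup (fun a => j ⁻¹ᵁ i ⁻¹ᵁ U a) = ⊤)
    (h0 : classOf (exactAugmentation (fun a => j ⁻¹ᵁ i ⁻¹ᵁ U a) M hcov) ω hω = 0) :
    ∃ (φ : ∀ a, Γ(Z₁, U a)) (_ : ∀ a, x a ∈ Z₁.basicOpen (φ a))
      (β : LocalFamily (fun a => j ⁻¹ᵁ i ⁻¹ᵁ Z₁.basicOpen (φ a)) 1 E M),
      restrictFamily (fun a => preimage₂_mono j i (Z₁.basicOpen_le (φ a))) ω = dFamily β := by
  obtain ⟨V, ⟨φ, hφ, rfl⟩, hVU, β, hβ⟩ := exists_refinement_eq_dFamily_of_classOf_eq_zero hcov ω hω h0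
    (fun V => ∃ φ : ∀ a, Γ(Z₁, U a), (∀ a, x a ∈ Z₁.basicOpen (φ a)) ∧
      V = fun a => j ⁻¹ᵁ i ⁻¹ᵁ Z₁.basicOpen (φ a))
    (fun X' f g w hS => by
      choose φ hφ r hr using exists_retraction_over_basicOpen j i U hUaff x hx hE X' f g w hS
      exact ⟨fun a => j ⁻¹ᵁ i ⁻¹ᵁ Z₁.basicOpen (φ a), ⟨φ, hφ, rfl⟩,
        iSup_preimage₂_eq_top_of_centres j i (fun a => Z₁.basicOpen (φ a)) x hφ hsurj,
        fun a => preimage₂_mono j i (Z₁.basicOpen_le (φ a)), fun a => ⟨r a, hr a⟩⟩)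
  exact ⟨φ, hφ, β, hβ⟩

end Cech

end Literature.AlgebraicGeometry.Modules

end
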